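import Mathlib.RingTheory.PowerSeries.Order
import Mathlib.RingTheory.PowerSeries.NoZeroDivisors
import Mathlib.Algebra.Polynomial.AlgebraMap
import Mathlib.NumberTheory.Padics.PadicIntegers
import Summits.BirchSwinnertonDyer.BirchSwinnertonDyer.Theorems.ResidualThetaTransportAtTwoThetaLayerLambdaCongruenceAtTwoLayerAlgebra
import HarnessLib

/-!
# Route `SignedLowerHalves`, crux L `SmallImageLowerHalfBothSigns` (item stmt-BirchSwinnertonDyer-23599), line `rtt_w3` —
# row **E2-num** of `Lines/rtt_w3-BRIEF-E2-g8.md` §2, part 1: the NORM-λ CALCULUS of power series over an ultrametric field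

Width seat `bsd-line-slh-p3-w3` g19 under LEAD `cruxlead-stmt-BirchSwinnertonDyer-23599` g8 (cell `bsd-ssimc`); ROUTE-INDEPENDENT
helper (`--supports stmt-BirchSwinnertonDyer-23599`); THEOREMS ONLY — no definition, no named fact, no instance, no `sorry`;
closes nothing; BSD is not proved by any of this.

WHY. After v13 the registered research stub `stub_charRoad_ns` of line `rtt_w3` is E2, the lower half of the signed main
conjecture of the partner Grössencharakter at the inert `p`, whose conclusion reads (verbatim shape)
`∃ d, (∀ k, ‖L_k‖ ≤ ‖L_d‖) ∧ (∀ k < d, ‖L_k‖ < ‖L_d‖) ∧ [F:ℚ_p]·(d + Σ_{v∈S₀} p^{v_p(f_ℓ)}·layerLambda(P_{g,ℓ}(ℓ⁻¹(1+X)))) ≤ λ(Dψ.X)`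
for the Pollack-congruent `L ∈ 𝒪⟦T⟧` read in `ℚ̄_p⟦T⟧`. The two clauses «the maximum coefficient norm is attained at `d`, and not
before» are the stub's CURRENCY for the Weierstrass λ-invariant of a power series (any `μ`); the LEAD's cut (BRIEF-E2 §2/§3) feeds
this from E2-PT/E2-K/E2-an through the numerology row E2-num:
`λ(Λ_𝒪/(c·L·∏_v 𝒫_v)) = [F:ℚ_p]·(d(L) + Σ_v p^{v_p(f_ℓ)}·layerLambda(…))`. This file is the coefficient-ring-free half of that
row: in the norm currency the λ-index is ADDITIVE under products, INVISIBLE to non-zero constants, equals `layerLambda` on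
polynomials, and the substitution `R ↦ R(h)` along a series `h` of λ-index `n ≥ 1` and Gauss norm `1` multiplies it by `n`
(so `R ↦ R((1+T)^f − 1)`, `f = p^k·u'`, gives `p^k·layerLambda R` — §3 supplies the λ-index `p^{v_p(f)}` of `(1+T)^f − 1` from the
residual order). Everything is stated for `PowerSeries K`, `K` any ultrametric normed field (`PadicAlgCl p` in the crux).

WHAT (all hypotheses/conclusions in the stub's two-clause shape `hle : ∀ k, ‖φ_k‖ ≤ ‖φ_d‖`, `hlt : ∀ k < d, ‖φ_k‖ < ‖φ_d‖`).
* §1 `normLambda_unique` (the index is unique), `eq_zero_iff_coeff_eq_zero_of_normLambda`, `norm_coeff_C_mul`,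
  `normLambda_C_mul_iff` (constants `c ≠ 0` are invisible), `normLambda_C` (a constant has index `0`), `normLambda_coe`
  (a polynomial `R` has index `layerLambda R` and Gauss norm `R.supNorm`).
* §2 **`normLambda_mul`** (Gauss's lemma with λ: indices add, Gauss norms multiply), `normLambda_prod` (finite products),
  `normLambda_pow`, **`normLambda_aeval`** (`R(h)` has index `layerLambda R · n` and Gauss norm `R.supNorm` for `h` of index
  `n ≥ 1` and Gauss norm `1`).
* §3 `normLambda_map_of_order_map_residue_eq` — for `φ ∈ ℤ_p⟦T⟧` whose reduction mod `p` has `T`-order `n`, the image of `φ`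
  under any norm-preserving `ℤ_p → A` has index `n` and Gauss norm `1` (the bridge from the residual-order currency of
  `…Theorems.LambdaLowerBoundO*` / `…EulerFactorUnitPower` to the stub's norm currency).

References: [Washington1997] §7.1 (Weierstrass preparation; `λ` = index of the first unit coefficient); [PollackWeston2011MT]
§3.1 (`λ` in the `T`-basis); the polynomial case is the tree's `ThetaLayerLambdaCongruenceAtTwo.supNorm_mul_and_layerLambda_mul`.
-/

set_option autoImplicit false
-- the Theorems namespace of this sub repeats the summit name by design (D-0017 nested layout)
set_option linter.dupNamespace false

noncomputable section

open PowerSeries Literature.NumberTheory.IwasawaTheory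
open Summit.BirchSwinnertonDyer.BirchSwinnertonDyer.Theorems.ThetaLayerLambdaCongruenceAtTwo

namespace Summit.BirchSwinnertonDyer.BirchSwinnertonDyer.Theorems.SmallImageRttE2Num

/-! ## §1. The norm-λ index: uniqueness, constants, polynomials -/

section Basic

variable {K : Type*} [NormedField K]

/-- **The norm-λ index is unique**: if the maximum coefficient norm of `φ` is attained at `d` and not before, and also at `d'`
and not before, then `d = d'`. [cite: Washington1997, §7.1] -/
theorem normLambda_unique {φ : PowerSeries K} {d d' : ℕ}
    (hle : ∀ k, ‖coeff k φ‖ ≤ ‖coeff d φ‖) (hlt : ∀ k, k < d → ‖coeff k φ‖ < ‖coeff d φ‖)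
    (hle' : ∀ k, ‖coeff k φ‖ ≤ ‖coeff d' φ‖) (hlt' : ∀ k, k < d' → ‖coeff k φ‖ < ‖coeff d' φ‖) :
    d = d' := by
  by_contra h
  rcases Nat.lt_or_gt_of_ne h with h1 | h1
  · exact (hlt' d h1).not_ge (hle d')
  · exact (hlt d' h1).not_ge (hle' d)

/-- Under the first norm-λ clause at `d`, `φ = 0` iff its `d`-th coefficient vanishes. [folklore] -/
theorem eq_zero_iff_coeff_eq_zero_of_normLambda {φ : PowerSeries K} {d : ℕ}
    (hle : ∀ k, ‖coeff k φ‖ ≤ ‖coeff d φ‖) : φ = 0 ↔ coeff d φ = 0 := by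
  constructor
  · rintro rfl
    rw [map_zero]
  · intro h
    ext k
    have hk := hle k
    rw [h, norm_zero, norm_le_zero_iff] at hk
    rw [hk, map_zero]

/-- `‖(C c · φ)_k‖ = ‖c‖·‖φ_k‖`. [folklore] -/
theorem norm_coeff_C_mul (c : K) (φ : PowerSeries K) (k : ℕ) : ‖coeff k (C c * φ)‖ = ‖c‖ * ‖coeff k φ‖ := by
  rw [coeff_C_mul, norm_mul]

/-- **Non-zero constants are invisible to the norm-λ index**: `C c · φ` satisfies the two clauses at `d` iff `φ` does
(`c ≠ 0`). [cite: Washington1997, §7.1] -/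
theorem normLambda_C_mul_iff {c : K} (hc : c ≠ 0) (φ : PowerSeries K) (d : ℕ) :
    ((∀ k, ‖coeff k (C c * φ)‖ ≤ ‖coeff d (C c * φ)‖) ∧ ∀ k, k < d → ‖coeff k (C c * φ)‖ < ‖coeff d (C c * φ)‖) ↔
      ((∀ k, ‖coeff k φ‖ ≤ ‖coeff d φ‖) ∧ ∀ k, k < d → ‖coeff k φ‖ < ‖coeff d φ‖) := by
  have hc' : 0 < ‖c‖ := norm_pos_iff.mpr hc
  simp only [norm_coeff_C_mul, mul_le_mul_iff_right₀ hc', mul_lt_mul_iff_right₀ hc']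

/-- A constant `C c` has norm-λ index `0` (Gauss norm `‖c‖`). [folklore] -/
theorem normLambda_C (c : K) :
    ‖coeff 0 (C c : PowerSeries K)‖ = ‖c‖ ∧ (∀ k, ‖coeff k (C c : PowerSeries K)‖ ≤ ‖coeff 0 (C c : PowerSeries K)‖) ∧
      ∀ k, k < 0 → ‖coeff k (C c : PowerSeries K)‖ < ‖coeff 0 (C c : PowerSeries K)‖ := by
  refine ⟨by rw [coeff_zero_C], fun k ↦ ?_, fun k hk ↦ absurd hk (Nat.not_lt_zero k)⟩
  rw [coeff_C, coeff_zero_C]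
  split_ifs
  · exact le_rfl
  · rw [norm_zero]; exact norm_nonneg _

/-- **A polynomial `R`, read as a power series, has norm-λ index `layerLambda R` and Gauss norm `R.supNorm`**
(`layerLambda` is by definition the first index at which the sup norm is attained). [cite: PollackWeston2011MT, §3.1] -/
theorem normLambda_coe (R : Polynomial K) :
    ‖coeff (layerLambda R) (R : PowerSeries K)‖ = R.supNorm ∧
      (∀ k, ‖coeff k (R : PowerSeries K)‖ ≤ ‖coeff (layerLambda R) (R : PowerSeries K)‖) ∧
      ∀ k, k < layerLambda R → ‖coeff k (R : PowerSeries K)‖ < ‖coeff (layerLambda R) (R : PowerSeries K)‖ := by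
  simp only [Polynomial.coeff_coe, norm_coeff_layerLambda]
  exact ⟨trivial, fun k ↦ R.le_supNorm k, fun k hk ↦ norm_coeff_lt_supNorm_of_lt_layerLambda hk⟩

end Basic

/-! ## §2. Products and substitution (ultrametric) -/

section Ultrametric

variable {K : Type*} [NormedField K] [IsUltrametricDist K]

/-- **Gauss's lemma with the norm-λ index.** Over an ultrametric normed field, if the non-zero series `φ`, `ψ` attain their
maximum coefficient norms first at `d₁`, `d₂`, then `φ·ψ` attains its maximum coefficient norm first at `d₁ + d₂`, and that
norm is `‖φ_{d₁}‖·‖ψ_{d₂}‖`: the `(d₁ + d₂)`-th coefficient is `φ_{d₁}ψ_{d₂}` plus terms of strictly smaller norm, every lower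
coefficient is a sum of terms of strictly smaller norm, every coefficient a sum of terms of norm at most that.
[cite: Washington1997, §7.1] [cite: PollackWeston2011MT, §3.1] -/
theorem normLambda_mul {φ ψ : PowerSeries K} {d₁ d₂ : ℕ} (hφ : φ ≠ 0) (hψ : ψ ≠ 0)
    (hle₁ : ∀ k, ‖coeff k φ‖ ≤ ‖coeff d₁ φ‖) (hlt₁ : ∀ k, k < d₁ → ‖coeff k φ‖ < ‖coeff d₁ φ‖)
    (hle₂ : ∀ k, ‖coeff k ψ‖ ≤ ‖coeff d₂ ψ‖) (hlt₂ : ∀ k, k < d₂ → ‖coeff k ψ‖ < ‖coeff d₂ ψ‖) :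
    ‖coeff (d₁ + d₂) (φ * ψ)‖ = ‖coeff d₁ φ‖ * ‖coeff d₂ ψ‖ ∧
      (∀ k, ‖coeff k (φ * ψ)‖ ≤ ‖coeff (d₁ + d₂) (φ * ψ)‖) ∧
      ∀ k, k < d₁ + d₂ → ‖coeff k (φ * ψ)‖ < ‖coeff (d₁ + d₂) (φ * ψ)‖ := by
  classical
  set N := ‖coeff d₁ φ‖ with hN
  set M := ‖coeff d₂ ψ‖ with hM
  have hNpos : 0 < N :=
    norm_pos_iff.mpr fun h ↦ hφ ((eq_zero_iff_coeff_eq_zero_of_normLambda hle₁).mpr h)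
  have hMpos : 0 < M :=
    norm_pos_iff.mpr fun h ↦ hψ ((eq_zero_iff_coeff_eq_zero_of_normLambda hle₂).mpr h)
  have hNM : 0 < N * M := mul_pos hNpos hMpos
  have hterm_le : ∀ i j, ‖coeff i φ * coeff j ψ‖ ≤ N * M := fun i j ↦ by
    rw [norm_mul]
    exact mul_le_mul (hle₁ i) (hle₂ j) (norm_nonneg _) hNpos.le
  have hterm_lt : ∀ i j, (i < d₁ ∨ j < d₂) → ‖coeff i φ * coeff j ψ‖ < N * M := by
    rintro i j (hi | hj)
    · rw [norm_mul]
      calc ‖coeff i φ‖ * ‖coeff j ψ‖ ≤ ‖coeff i φ‖ * M := mul_le_mul_of_nonneg_left (hle₂ j) (norm_nonneg _)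
        _ < N * M := mul_lt_mul_of_pos_right (hlt₁ i hi) hMpos
    · rw [norm_mul]
      calc ‖coeff i φ‖ * ‖coeff j ψ‖ ≤ N * ‖coeff j ψ‖ := mul_le_mul_of_nonneg_right (hle₁ i) (norm_nonneg _)
        _ < N * M := mul_lt_mul_of_pos_left (hlt₂ j hj) hNpos
  have hcoeff_le : ∀ k, ‖coeff k (φ * ψ)‖ ≤ N * M := fun k ↦ by
    rw [coeff_mul]
    exact norm_sum_le_of_forall_le' hNM.le fun x _ ↦ hterm_le x.1 x.2
  have hcoeff_lt : ∀ k, k < d₁ + d₂ → ‖coeff k (φ * ψ)‖ < N * M := fun k hk ↦ by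
    rw [coeff_mul]
    refine norm_sum_lt_of_forall_lt hNM fun x hx ↦ hterm_lt x.1 x.2 ?_
    rw [Finset.mem_antidiagonal] at hx
    omega
  have hmain : ‖coeff (d₁ + d₂) (φ * ψ)‖ = N * M := by
    have hmem : (d₁, d₂) ∈ Finset.antidiagonal (d₁ + d₂) := by simp
    rw [coeff_mul, ← Finset.add_sum_erase _ _ hmem]
    have h1 : ‖coeff d₁ φ * coeff d₂ ψ‖ = N * M := by rw [norm_mul]
    have h2 : ‖∑ x ∈ (Finset.antidiagonal (d₁ + d₂)).erase (d₁, d₂), coeff x.1 φ * coeff x.2 ψ‖ < N * M := by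
      refine norm_sum_lt_of_forall_lt hNM fun x hx ↦ hterm_lt x.1 x.2 ?_
      rw [Finset.mem_erase, Finset.mem_antidiagonal] at hx
      obtain ⟨hne, hsum⟩ := hx
      by_contra hcon
      push Not at hcon
      obtain ⟨h1', h2'⟩ := hcon
      apply hne
      exact Prod.ext (by change x.1 = d₁; omega) (by change x.2 = d₂; omega)
    apply norm_eq_of_norm_sub_lt_of_norm_eq (a := coeff d₁ φ * coeff d₂ ψ) _ h1
    rwa [sub_add_cancel_left, norm_neg]
  refine ⟨hmain, fun k ↦ ?_, fun k hk ↦ ?_⟩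
  · rw [hmain]; exact hcoeff_le k
  · rw [hmain]; exact hcoeff_lt k hk

/-- **Finite products**: if each non-zero `φ i` (`i ∈ s`) attains its maximum coefficient norm first at `d i`, then `∏ φ i`
attains its maximum coefficient norm first at `∑ d i`, with value `∏ ‖(φ i)_{d i}‖`. [cite: Washington1997, §7.1] -/
theorem normLambda_prod {ι : Type*} (s : Finset ι) (φ : ι → PowerSeries K) (d : ι → ℕ)
    (h0 : ∀ i ∈ s, φ i ≠ 0)
    (hle : ∀ i ∈ s, ∀ k, ‖coeff k (φ i)‖ ≤ ‖coeff (d i) (φ i)‖)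
    (hlt : ∀ i ∈ s, ∀ k, k < d i → ‖coeff k (φ i)‖ < ‖coeff (d i) (φ i)‖) :
    ‖coeff (∑ i ∈ s, d i) (∏ i ∈ s, φ i)‖ = ∏ i ∈ s, ‖coeff (d i) (φ i)‖ ∧
      (∀ k, ‖coeff k (∏ i ∈ s, φ i)‖ ≤ ‖coeff (∑ i ∈ s, d i) (∏ i ∈ s, φ i)‖) ∧
      ∀ k, k < ∑ i ∈ s, d i → ‖coeff k (∏ i ∈ s, φ i)‖ < ‖coeff (∑ i ∈ s, d i) (∏ i ∈ s, φ i)‖ := by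
  classical
  induction s using Finset.induction_on with
  | empty =>
    refine ⟨?_, fun k ↦ ?_, fun k hk ↦ absurd hk (by simp)⟩
    · simp
    · simp only [Finset.prod_empty, Finset.sum_empty, coeff_one]
      split_ifs <;> simp
  | insert a s ha ih =>
    obtain ⟨ihn, ihle, ihlt⟩ := ih (fun i hi ↦ h0 i (Finset.mem_insert_of_mem hi))
      (fun i hi ↦ hle i (Finset.mem_insert_of_mem hi)) (fun i hi ↦ hlt i (Finset.mem_insert_of_mem hi))
    have hprod : ∏ i ∈ s, φ i ≠ 0 :=
      Finset.prod_ne_zero_iff.mpr fun i hi ↦ h0 i (Finset.mem_insert_of_mem hi)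
    rw [Finset.prod_insert ha, Finset.sum_insert ha, Finset.prod_insert ha]
    obtain ⟨hn, hle', hlt'⟩ := normLambda_mul (h0 a (Finset.mem_insert_self a s)) hprod
      (hle a (Finset.mem_insert_self a s)) (hlt a (Finset.mem_insert_self a s)) ihle ihlt
    exact ⟨by rw [hn, ihn], hle', hlt'⟩

/-- **Powers**: if the non-zero `φ` attains its maximum coefficient norm first at `d`, then `φ ^ n` does so first at `n·d`,
with value `‖φ_d‖ ^ n`. [cite: Washington1997, §7.1] -/
theorem normLambda_pow {φ : PowerSeries K} {d : ℕ} (hφ : φ ≠ 0)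
    (hle : ∀ k, ‖coeff k φ‖ ≤ ‖coeff d φ‖) (hlt : ∀ k, k < d → ‖coeff k φ‖ < ‖coeff d φ‖) (n : ℕ) :
    ‖coeff (n * d) (φ ^ n)‖ = ‖coeff d φ‖ ^ n ∧
      (∀ k, ‖coeff k (φ ^ n)‖ ≤ ‖coeff (n * d) (φ ^ n)‖) ∧
      ∀ k, k < n * d → ‖coeff k (φ ^ n)‖ < ‖coeff (n * d) (φ ^ n)‖ := by
  have h := normLambda_prod (Finset.range n) (fun _ ↦ φ) (fun _ ↦ d) (fun _ _ ↦ hφ) (fun _ _ ↦ hle) (fun _ _ ↦ hlt)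
  simp only [Finset.prod_const, Finset.sum_const, Finset.card_range, smul_eq_mul] at h
  exact h

/-- **Substitution.** Let `R ≠ 0` be a polynomial and `h` a power series attaining its maximum coefficient norm `1` first
at the index `n ≥ 1`. Then `R(h) = aeval h R` attains its maximum coefficient norm first at `layerLambda R · n`, and that
norm is `R.supNorm`: writing `R(h) = ∑_j R_j h^j`, the term `j = layerLambda R` contributes `R_j·(h^j)_{jn}` of norm
`‖R‖_sup` in degree `jn` and every other contribution there or below has strictly smaller norm (`h^j` has index `jn`, Gauss
norm `1`). With `h = (1+T)^f − 1` this is the layer-free local term of E2-num. [cite: Washington1997, §7.1]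
[cite: GreenbergVatsal2000, §2 Prop. (2.4)] -/
theorem normLambda_aeval {R : Polynomial K} (hR : R ≠ 0) {h : PowerSeries K} {n : ℕ} (hn : 0 < n)
    (h1 : ‖coeff n h‖ = 1) (hle : ∀ k, ‖coeff k h‖ ≤ ‖coeff n h‖) (hlt : ∀ k, k < n → ‖coeff k h‖ < ‖coeff n h‖) :
    ‖coeff (layerLambda R * n) (Polynomial.aeval h R)‖ = R.supNorm ∧
      (∀ k, ‖coeff k (Polynomial.aeval h R)‖ ≤ ‖coeff (layerLambda R * n) (Polynomial.aeval h R)‖) ∧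
      ∀ k, k < layerLambda R * n →
        ‖coeff k (Polynomial.aeval h R)‖ < ‖coeff (layerLambda R * n) (Polynomial.aeval h R)‖ := by
  classical
  set m := layerLambda R with hm
  set N := R.supNorm with hNdef
  have hNpos : 0 < N :=
    lt_of_le_of_ne (Polynomial.supNorm_nonneg R) (Ne.symm ((Polynomial.supNorm_eq_zero_iff R).not.mpr hR))
  have hh0 : h ≠ 0 := fun h0 ↦ by
    rw [h0, map_zero, norm_zero] at h1
    exact zero_ne_one h1
  -- `h ^ j` : index `j * n`, Gauss norm `1`
  have hpow : ∀ j, ‖coeff (j * n) (h ^ j)‖ = 1 ∧ (∀ k, ‖coeff k (h ^ j)‖ ≤ 1) ∧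
      ∀ k, k < j * n → ‖coeff k (h ^ j)‖ < 1 := fun j ↦ by
    obtain ⟨hv, hle', hlt'⟩ := normLambda_pow hh0 hle hlt j
    rw [h1, one_pow] at hv
    exact ⟨hv, fun k ↦ (hle' k).trans_eq hv, fun k hk ↦ (hlt' k hk).trans_eq hv⟩
  -- coefficients of `aeval h R`
  have hcoeff : ∀ k, coeff k (Polynomial.aeval h R) =
      ∑ j ∈ Finset.range (R.natDegree + 1), R.coeff j * coeff k (h ^ j) := fun k ↦ by
    rw [Polynomial.aeval_eq_sum_range, map_sum]
    refine Finset.sum_congr rfl fun j _ ↦ ?_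
    rw [smul_eq_C_mul, coeff_C_mul]
  -- single terms
  have hterm_le : ∀ j k, ‖R.coeff j * coeff k (h ^ j)‖ ≤ N := fun j k ↦ by
    rw [norm_mul]
    calc ‖R.coeff j‖ * ‖coeff k (h ^ j)‖ ≤ N * 1 :=
          mul_le_mul (R.le_supNorm j) ((hpow j).2.1 k) (norm_nonneg _) hNpos.le
      _ = N := mul_one N
  have hterm_lt : ∀ j k, (j < m ∨ k < j * n) → ‖R.coeff j * coeff k (h ^ j)‖ < N := by
    rintro j k (hj | hk)
    · rw [norm_mul]
      calc ‖R.coeff j‖ * ‖coeff k (h ^ j)‖ ≤ ‖R.coeff j‖ * 1 :=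
            mul_le_mul_of_nonneg_left ((hpow j).2.1 k) (norm_nonneg _)
        _ < N := by rw [mul_one]; exact norm_coeff_lt_supNorm_of_lt_layerLambda hj
    · rw [norm_mul]
      calc ‖R.coeff j‖ * ‖coeff k (h ^ j)‖ ≤ N * ‖coeff k (h ^ j)‖ :=
            mul_le_mul_of_nonneg_right (R.le_supNorm j) (norm_nonneg _)
        _ < N := mul_lt_of_lt_one_right hNpos ((hpow j).2.2 k hk)
  have hall_le : ∀ k, ‖coeff k (Polynomial.aeval h R)‖ ≤ N := fun k ↦ by
    rw [hcoeff]
    exact norm_sum_le_of_forall_le' hNpos.le fun j _ ↦ hterm_le j k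
  have hall_lt : ∀ k, k < m * n → ‖coeff k (Polynomial.aeval h R)‖ < N := fun k hk ↦ by
    rw [hcoeff]
    refine norm_sum_lt_of_forall_lt hNpos fun j _ ↦ hterm_lt j k ?_
    by_cases hj : j < m
    · exact Or.inl hj
    · right
      push Not at hj
      exact lt_of_lt_of_le hk (Nat.mul_le_mul_right n hj)
  have hmain : ‖coeff (m * n) (Polynomial.aeval h R)‖ = N := by
    have hmem : m ∈ Finset.range (R.natDegree + 1) :=
      Finset.mem_range.mpr (Nat.lt_succ_of_le (layerLambda_le_natDegree hR))
    rw [hcoeff, ← Finset.add_sum_erase _ _ hmem]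
    have h1' : ‖R.coeff m * coeff (m * n) (h ^ m)‖ = N := by
      rw [norm_mul, (hpow m).1, mul_one, hm, norm_coeff_layerLambda]
    have h2 : ‖∑ j ∈ (Finset.range (R.natDegree + 1)).erase m, R.coeff j * coeff (m * n) (h ^ j)‖ < N := by
      refine norm_sum_lt_of_forall_lt hNpos fun j hj ↦ hterm_lt j (m * n) ?_
      rw [Finset.mem_erase] at hj
      rcases Nat.lt_or_gt_of_ne hj.1 with hjm | hjm
      · exact Or.inl hjm
      · exact Or.inr (Nat.mul_lt_mul_of_pos_right hjm hn)
    apply norm_eq_of_norm_sub_lt_of_norm_eq (a := R.coeff m * coeff (m * n) (h ^ m)) _ h1'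
    rwa [sub_add_cancel_left, norm_neg]
  refine ⟨hmain, fun k ↦ ?_, fun k hk ↦ ?_⟩
  · rw [hmain]; exact hall_le k
  · rw [hmain]; exact hall_lt k hk

end Ultrametric

/-! ## §3. From the residual `T`-order over `ℤ_p` to the norm currency -/

section Residue

variable {p : ℕ} [Fact p.Prime] {A : Type*} [NormedRing A]

/-- **Residual order ⇒ norm-λ index.** If `φ ∈ ℤ_p⟦T⟧` reduces modulo `p` to a series of `T`-order `n`, then along any
norm-preserving ring map `f : ℤ_p → A` the series `φ^f` has `‖(φ^f)_n‖ = 1`, all coefficients of norm `≤ ‖(φ^f)_n‖`, and those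
below `n` of norm `< ‖(φ^f)_n‖` (a `p`-adic integer is a unit iff its norm is `1`, and lies in `(p)` iff its norm is `< 1`).
[cite: Washington1997, §7.1] -/
theorem normLambda_map_of_order_map_residue_eq (f : ℤ_[p] →+* A) (hf : ∀ x, ‖f x‖ = ‖x‖) (φ : PowerSeries ℤ_[p])
    {n : ℕ} (hord : (φ.map (IsLocalRing.residue ℤ_[p])).order = n) :
    ‖coeff n (φ.map f)‖ = 1 ∧ (∀ k, ‖coeff k (φ.map f)‖ ≤ ‖coeff n (φ.map f)‖) ∧
      ∀ k, k < n → ‖coeff k (φ.map f)‖ < ‖coeff n (φ.map f)‖ := by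
  rw [order_eq_nat] at hord
  obtain ⟨hn, hlow⟩ := hord
  simp only [coeff_map] at hn hlow ⊢
  have h1 : ‖coeff n φ‖ = 1 := by
    refine le_antisymm (PadicInt.norm_le_one _) ?_
    by_contra hlt
    push Not at hlt
    exact hn ((IsLocalRing.residue_eq_zero_iff _).mpr (PadicInt.mem_nonunits.mpr hlt))
  simp only [hf, h1]
  refine ⟨trivial, fun k ↦ PadicInt.norm_le_one _, fun k hk ↦ ?_⟩
  exact PadicInt.mem_nonunits.mp ((IsLocalRing.residue_eq_zero_iff _).mp (hlow k hk))

end Residue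

end Summit.BirchSwinnertonDyer.BirchSwinnertonDyer.Theorems.SmallImageRttE2Num

end
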